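import Literature.NumberTheory.Irrationality.Fischler2002.RhinViolaGroup32Proofs
import HarnessLib

/-!
# Fischler 2002, Proposition 3.1 — the group `⟨σ, ψ, χ⟩`, II: the 32 words and the order (proofs only)

Topic `Literature/NumberTheory/Irrationality/Fischler2002`. PROOFS ONLY (no definition, no statement), sequel of
`RhinViolaGroup32Proofs.lean` toward the named fact `prop31` of `RhinViolaGroupsGeneral.lean`
([Fischler2002Polyzetas, §3 Proposition 3.1] = [Fischler2003RhinViola, §4.3 Théorème 8]: for `n ≥ 3` the maps
`σ, ψ, χ` generate a group of order `32 ≅ (D₂ × D₂) ⋊ ℤ/2ℤ`).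

For ANY permutations `gσ gψ gχ : Equiv.Perm Exponents` with underlying maps `sigma`, `psi n`, `chi n` (`n ≥ 3`) and
the word map `W e α β γ δ = ψ^e σ^α χ'^β χ^γ σ'^δ` (`χ' = ψχψ`, `σ' = ψσψ`; `W` is a free function symbol with its
defining hypothesis `hW`, so that no definition is introduced):

* `Prop31.psi_mul_word`, `sigma_mul_word_false/true`, `chi_mul_word_false/true` — left multiplication by a generator
  permutes the 32 words (`σψ = ψσ'`, `χψ = ψχ'`, and `N = ⟨σ, χ', χ, σ'⟩` is generated by pairwise commuting
  involutions — part I);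
* `Prop31.exists_word_of_mem_closure`, `coe_closure_eq_range` — hence `⟨σ, ψ, χ⟩` IS the set of the 32 words
  (`Subgroup.closure_induction_left`);
* `Prop31.word_injective` — the 32 words are pairwise distinct for every `n ≥ 3`: the coordinates `(a₁, a_n)` of the
  image of ONE test point (`a₁ = 1, a₂ = 2, b₂ = 5, a_n = n+10, b_n = n+20, c_n = n+12`, zero elsewhere) take the 32
  distinct values `{1, 5, 7, −1} × {n+10, n+20, n+12, n+18}` (and swapped);
* `Prop31.card_closure_eq` — **`Nat.card ⟨σ, ψ, χ⟩ = 32`** for every `n ≥ 3` (the first half of `prop31`).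

HONEST FRAMING (cell pub-zeta5): systematic search; no irrationality claim unless certified — bookkeeping of a printed
group order; nothing about `ζ(5)`.
-/

namespace Literature.NumberTheory.Irrationality.Fischler2002

namespace Prop31

/-! ### Two generic facts about `bif b then x else 1` in a monoid -/

/-- In a monoid, if `x` commutes with `y` then `x` commutes with `bif b then y else 1`. [folklore] -/
private theorem mul_cond_one_comm {M : Type*} [Monoid M] {x y : M} (h : x * y = y * x) (b : Bool) :
    x * (bif b then y else 1) = (bif b then y else 1) * x := by
  cases b <;> simp [h]

/-- In a monoid, if `y * y = 1` then `y * (bif b then y else 1) = bif !b then y else 1`. [folklore] -/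
private theorem mul_cond_one_self {M : Type*} [Monoid M] {y : M} (h : y * y = 1) (b : Bool) :
    y * (bif b then y else 1) = bif !b then y else 1 := by
  cases b <;> simp [h]

/-! ### The 32 words `ψ^e σ^α χ'^β χ^γ σ'^δ` and the left multiplication rules -/

section Words

variable {n : ℕ} {gσ gψ gχ : Equiv.Perm Exponents}
  {W : Bool → Bool → Bool → Bool → Bool → Equiv.Perm Exponents}

/-- `σ'² = 1` for `σ' = ψσψ`. [cite: Fischler2002Polyzetas, §3 Proposition 3.1] -/
theorem perm_sigma'_mul_self (hn : 3 ≤ n) (hσ : ⇑gσ = sigma) (hψ : ⇑gψ = psi n) :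
    gψ * gσ * gψ * (gψ * gσ * gψ) = 1 :=
  Equiv.ext fun p => by
    simp only [Equiv.Perm.mul_apply, Equiv.Perm.one_apply, hσ, hψ, psi_psi (show 2 ≤ n by omega), sigma_sigma]

/-- `χ'² = 1` for `χ' = ψχψ`. [cite: Fischler2002Polyzetas, §3 Proposition 3.1] -/
theorem perm_chi'_mul_self (hn : 3 ≤ n) (hψ : ⇑gψ = psi n) (hχ : ⇑gχ = chi n) :
    gψ * gχ * gψ * (gψ * gχ * gψ) = 1 :=
  Equiv.ext fun p => by
    simp only [Equiv.Perm.mul_apply, Equiv.Perm.one_apply, hχ, hψ, psi_psi (show 2 ≤ n by omega), chi_chi]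

/-- `ψ · W(e,α,β,γ,δ) = W(¬e,α,β,γ,δ)`. [cite: Fischler2002Polyzetas, §3 Proposition 3.1] -/
theorem psi_mul_word (hn : 3 ≤ n) (hψ : ⇑gψ = psi n)
    (hW : ∀ e α β γ δ, W e α β γ δ = (bif e then gψ else 1) * (bif α then gσ else 1) *
      (bif β then gψ * gχ * gψ else 1) * (bif γ then gχ else 1) * (bif δ then gψ * gσ * gψ else 1))
    (e α β γ δ : Bool) : gψ * W e α β γ δ = W (!e) α β γ δ := by
  rw [hW, hW, ← mul_cond_one_self (perm_psi_mul_self (by omega : 2 ≤ n) hψ) e]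
  simp only [mul_assoc]

/-- `σ · W(false,α,β,γ,δ) = W(false,¬α,β,γ,δ)`. [cite: Fischler2002Polyzetas, §3 Proposition 3.1] -/
theorem sigma_mul_word_false (hσ : ⇑gσ = sigma)
    (hW : ∀ e α β γ δ, W e α β γ δ = (bif e then gψ else 1) * (bif α then gσ else 1) *
      (bif β then gψ * gχ * gψ else 1) * (bif γ then gχ else 1) * (bif δ then gψ * gσ * gψ else 1))
    (α β γ δ : Bool) : gσ * W false α β γ δ = W false (!α) β γ δ := by
  rw [hW, hW, ← mul_cond_one_self (perm_sigma_mul_self hσ) α]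
  simp only [cond_false, one_mul, mul_assoc]

/-- `σ · W(true,α,β,γ,δ) = W(true,α,β,γ,¬δ)` (`σψ = ψσ'` and `σ'` is central in `N`).
[cite: Fischler2002Polyzetas, §3 Proposition 3.1] -/
theorem sigma_mul_word_true (hn : 3 ≤ n) (hσ : ⇑gσ = sigma) (hψ : ⇑gψ = psi n) (hχ : ⇑gχ = chi n)
    (hW : ∀ e α β γ δ, W e α β γ δ = (bif e then gψ else 1) * (bif α then gσ else 1) *
      (bif β then gψ * gχ * gψ else 1) * (bif γ then gχ else 1) * (bif δ then gψ * gσ * gψ else 1))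
    (α β γ δ : Bool) : gσ * W true α β γ δ = W true α β γ (!δ) := by
  have hψψ := perm_psi_mul_self (by omega : 2 ≤ n) hψ
  have hS : gσ * gψ = gψ * (gψ * gσ * gψ) := by
    rw [← mul_assoc, ← mul_assoc, hψψ, one_mul]
  have cA := mul_cond_one_comm (perm_sigma_sigma' hn hσ hψ).symm α
  have cB := mul_cond_one_comm (perm_chi'_sigma' hn hσ hψ hχ).symm β
  have cC := mul_cond_one_comm (perm_chi_sigma' hn hσ hψ hχ).symm γ
  have cD := mul_cond_one_self (perm_sigma'_mul_self hn hσ hψ) δ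
  rw [hW, hW]
  simp only [cond_true]
  calc gσ * (gψ * (bif α then gσ else 1) * (bif β then gψ * gχ * gψ else 1) * (bif γ then gχ else 1) *
          (bif δ then gψ * gσ * gψ else 1))
      = (gσ * gψ) * (bif α then gσ else 1) * (bif β then gψ * gχ * gψ else 1) * (bif γ then gχ else 1) *
          (bif δ then gψ * gσ * gψ else 1) := by simp only [mul_assoc]
    _ = gψ * ((gψ * gσ * gψ) * (bif α then gσ else 1)) * (bif β then gψ * gχ * gψ else 1) *
          (bif γ then gχ else 1) * (bif δ then gψ * gσ * gψ else 1) := by rw [hS]; simp only [mul_assoc]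
    _ = gψ * (bif α then gσ else 1) * ((gψ * gσ * gψ) * (bif β then gψ * gχ * gψ else 1)) *
          (bif γ then gχ else 1) * (bif δ then gψ * gσ * gψ else 1) := by rw [cA]; simp only [mul_assoc]
    _ = gψ * (bif α then gσ else 1) * (bif β then gψ * gχ * gψ else 1) * ((gψ * gσ * gψ) *
          (bif γ then gχ else 1)) * (bif δ then gψ * gσ * gψ else 1) := by rw [cB]; simp only [mul_assoc]
    _ = gψ * (bif α then gσ else 1) * (bif β then gψ * gχ * gψ else 1) * (bif γ then gχ else 1) *
          ((gψ * gσ * gψ) * (bif δ then gψ * gσ * gψ else 1)) := by rw [cC]; simp only [mul_assoc]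
    _ = gψ * (bif α then gσ else 1) * (bif β then gψ * gχ * gψ else 1) * (bif γ then gχ else 1) *
          (bif !δ then gψ * gσ * gψ else 1) := by rw [cD]

/-- `χ · W(false,α,β,γ,δ) = W(false,α,β,¬γ,δ)`. [cite: Fischler2002Polyzetas, §3 Proposition 3.1] -/
theorem chi_mul_word_false (hn : 3 ≤ n) (hσ : ⇑gσ = sigma) (hψ : ⇑gψ = psi n) (hχ : ⇑gχ = chi n)
    (hW : ∀ e α β γ δ, W e α β γ δ = (bif e then gψ else 1) * (bif α then gσ else 1) *
      (bif β then gψ * gχ * gψ else 1) * (bif γ then gχ else 1) * (bif δ then gψ * gσ * gψ else 1))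
    (α β γ δ : Bool) : gχ * W false α β γ δ = W false α β (!γ) δ := by
  have cA := mul_cond_one_comm (perm_sigma_chi hn hσ hχ).symm α
  have cB := mul_cond_one_comm (perm_chi_chi' hn hψ hχ) β
  have cC := mul_cond_one_self (perm_chi_mul_self hχ) γ
  rw [hW, hW]
  simp only [cond_false, one_mul]
  calc gχ * ((bif α then gσ else 1) * (bif β then gψ * gχ * gψ else 1) * (bif γ then gχ else 1) *
          (bif δ then gψ * gσ * gψ else 1))
      = (gχ * (bif α then gσ else 1)) * (bif β then gψ * gχ * gψ else 1) * (bif γ then gχ else 1) *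
          (bif δ then gψ * gσ * gψ else 1) := by simp only [mul_assoc]
    _ = (bif α then gσ else 1) * (gχ * (bif β then gψ * gχ * gψ else 1)) * (bif γ then gχ else 1) *
          (bif δ then gψ * gσ * gψ else 1) := by rw [cA]; simp only [mul_assoc]
    _ = (bif α then gσ else 1) * (bif β then gψ * gχ * gψ else 1) * (gχ * (bif γ then gχ else 1)) *
          (bif δ then gψ * gσ * gψ else 1) := by rw [cB]; simp only [mul_assoc]
    _ = (bif α then gσ else 1) * (bif β then gψ * gχ * gψ else 1) * (bif !γ then gχ else 1) *
          (bif δ then gψ * gσ * gψ else 1) := by rw [cC]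

/-- `χ · W(true,α,β,γ,δ) = W(true,α,¬β,γ,δ)` (`χψ = ψχ'`). [cite: Fischler2002Polyzetas, §3 Proposition 3.1] -/
theorem chi_mul_word_true (hn : 3 ≤ n) (hσ : ⇑gσ = sigma) (hψ : ⇑gψ = psi n) (hχ : ⇑gχ = chi n)
    (hW : ∀ e α β γ δ, W e α β γ δ = (bif e then gψ else 1) * (bif α then gσ else 1) *
      (bif β then gψ * gχ * gψ else 1) * (bif γ then gχ else 1) * (bif δ then gψ * gσ * gψ else 1))
    (α β γ δ : Bool) : gχ * W true α β γ δ = W true α (!β) γ δ := by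
  have hψψ := perm_psi_mul_self (by omega : 2 ≤ n) hψ
  have hS : gχ * gψ = gψ * (gψ * gχ * gψ) := by
    rw [← mul_assoc, ← mul_assoc, hψψ, one_mul]
  have cA := mul_cond_one_comm (perm_sigma_chi' hn hσ hψ hχ).symm α
  have cB := mul_cond_one_self (perm_chi'_mul_self hn hψ hχ) β
  rw [hW, hW]
  simp only [cond_true]
  calc gχ * (gψ * (bif α then gσ else 1) * (bif β then gψ * gχ * gψ else 1) * (bif γ then gχ else 1) *
          (bif δ then gψ * gσ * gψ else 1))
      = (gχ * gψ) * (bif α then gσ else 1) * (bif β then gψ * gχ * gψ else 1) * (bif γ then gχ else 1) *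
          (bif δ then gψ * gσ * gψ else 1) := by simp only [mul_assoc]
    _ = gψ * ((gψ * gχ * gψ) * (bif α then gσ else 1)) * (bif β then gψ * gχ * gψ else 1) *
          (bif γ then gχ else 1) * (bif δ then gψ * gσ * gψ else 1) := by rw [hS]; simp only [mul_assoc]
    _ = gψ * (bif α then gσ else 1) * ((gψ * gχ * gψ) * (bif β then gψ * gχ * gψ else 1)) *
          (bif γ then gχ else 1) * (bif δ then gψ * gσ * gψ else 1) := by rw [cA]; simp only [mul_assoc]
    _ = gψ * (bif α then gσ else 1) * (bif !β then gψ * gχ * gψ else 1) *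
          (bif γ then gχ else 1) * (bif δ then gψ * gσ * gψ else 1) := by rw [cB]

end Words

/-! ### The subgroup generated by `σ, ψ, χ` is the set of the 32 words -/

section Closure

variable {n : ℕ} {gσ gψ gχ : Equiv.Perm Exponents}
  {W : Bool → Bool → Bool → Bool → Bool → Equiv.Perm Exponents}

/-- Each word lies in `⟨σ, ψ, χ⟩`. [cite: Fischler2002Polyzetas, §3 Proposition 3.1] -/
theorem word_mem_closure
    (hW : ∀ e α β γ δ, W e α β γ δ = (bif e then gψ else 1) * (bif α then gσ else 1) *
      (bif β then gψ * gχ * gψ else 1) * (bif γ then gχ else 1) * (bif δ then gψ * gσ * gψ else 1))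
    (e α β γ δ : Bool) : W e α β γ δ ∈ Subgroup.closure ({gσ, gψ, gχ} : Set (Equiv.Perm Exponents)) := by
  have hσm : gσ ∈ Subgroup.closure ({gσ, gψ, gχ} : Set (Equiv.Perm Exponents)) :=
    Subgroup.subset_closure (by simp)
  have hψm : gψ ∈ Subgroup.closure ({gσ, gψ, gχ} : Set (Equiv.Perm Exponents)) :=
    Subgroup.subset_closure (by simp)
  have hχm : gχ ∈ Subgroup.closure ({gσ, gψ, gχ} : Set (Equiv.Perm Exponents)) :=
    Subgroup.subset_closure (by simp)
  have hc : ∀ (b : Bool) (x : Equiv.Perm Exponents),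
      x ∈ Subgroup.closure ({gσ, gψ, gχ} : Set (Equiv.Perm Exponents)) →
        (bif b then x else 1) ∈ Subgroup.closure ({gσ, gψ, gχ} : Set (Equiv.Perm Exponents)) := by
    intro b x hx
    cases b
    · exact one_mem _
    · exact hx
  rw [hW]
  exact mul_mem (mul_mem (mul_mem (mul_mem (hc e _ hψm) (hc α _ hσm))
    (hc β _ (mul_mem (mul_mem hψm hχm) hψm))) (hc γ _ hχm)) (hc δ _ (mul_mem (mul_mem hψm hσm) hψm))

/-- Left multiplication by a generator maps words to words. [cite: Fischler2002Polyzetas, §3 Proposition 3.1] -/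
theorem gen_mul_word (hn : 3 ≤ n) (hσ : ⇑gσ = sigma) (hψ : ⇑gψ = psi n) (hχ : ⇑gχ = chi n)
    (hW : ∀ e α β γ δ, W e α β γ δ = (bif e then gψ else 1) * (bif α then gσ else 1) *
      (bif β then gψ * gχ * gψ else 1) * (bif γ then gχ else 1) * (bif δ then gψ * gσ * gψ else 1))
    {x : Equiv.Perm Exponents} (hx : x ∈ ({gσ, gψ, gχ} : Set (Equiv.Perm Exponents))) (e α β γ δ : Bool) :
    ∃ e' α' β' γ' δ', x * W e α β γ δ = W e' α' β' γ' δ' := by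
  simp only [Set.mem_insert_iff, Set.mem_singleton_iff] at hx
  rcases hx with rfl | rfl | rfl
  · cases e
    · exact ⟨_, _, _, _, _, sigma_mul_word_false hσ hW α β γ δ⟩
    · exact ⟨_, _, _, _, _, sigma_mul_word_true hn hσ hψ hχ hW α β γ δ⟩
  · exact ⟨_, _, _, _, _, psi_mul_word hn hψ hW e α β γ δ⟩
  · cases e
    · exact ⟨_, _, _, _, _, chi_mul_word_false hn hσ hψ hχ hW α β γ δ⟩
    · exact ⟨_, _, _, _, _, chi_mul_word_true hn hσ hψ hχ hW α β γ δ⟩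

/-- The generators are involutions, hence their own inverses. [cite: Fischler2002Polyzetas, §3 p. 3] -/
theorem gen_inv_eq (hn : 3 ≤ n) (hσ : ⇑gσ = sigma) (hψ : ⇑gψ = psi n) (hχ : ⇑gχ = chi n)
    {x : Equiv.Perm Exponents} (hx : x ∈ ({gσ, gψ, gχ} : Set (Equiv.Perm Exponents))) : x⁻¹ = x := by
  simp only [Set.mem_insert_iff, Set.mem_singleton_iff] at hx
  rcases hx with rfl | rfl | rfl
  · exact inv_eq_of_mul_eq_one_right (perm_sigma_mul_self hσ)
  · exact inv_eq_of_mul_eq_one_right (perm_psi_mul_self (by omega) hψ)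
  · exact inv_eq_of_mul_eq_one_right (perm_chi_mul_self hχ)

/-- **`⟨σ, ψ, χ⟩ = {ψ^e σ^α χ'^β χ^γ σ'^δ}`**: every element of the subgroup generated by `σ, ψ, χ` is one of
the 32 words (the printed structure `(D₂ × D₂) ⋊ ℤ/2ℤ`: `N = ⟨σ, χ'⟩ × ⟨χ, σ'⟩` normal of index 2, `ψ` swapping
the factors). [cite: Fischler2002Polyzetas, §3 Proposition 3.1] -/
theorem exists_word_of_mem_closure (hn : 3 ≤ n) (hσ : ⇑gσ = sigma) (hψ : ⇑gψ = psi n) (hχ : ⇑gχ = chi n)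
    (hW : ∀ e α β γ δ, W e α β γ δ = (bif e then gψ else 1) * (bif α then gσ else 1) *
      (bif β then gψ * gχ * gψ else 1) * (bif γ then gχ else 1) * (bif δ then gψ * gσ * gψ else 1))
    {g : Equiv.Perm Exponents} (hg : g ∈ Subgroup.closure ({gσ, gψ, gχ} : Set (Equiv.Perm Exponents))) :
    ∃ e α β γ δ, g = W e α β γ δ := by
  induction hg using Subgroup.closure_induction_left with
  | one => exact ⟨false, false, false, false, false, by rw [hW]; simp⟩
  | mul_left x hx y hy ih =>
    obtain ⟨e, α, β, γ, δ, rfl⟩ := ih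
    exact gen_mul_word hn hσ hψ hχ hW hx e α β γ δ
  | inv_mul_cancel x hx y hy ih =>
    obtain ⟨e, α, β, γ, δ, rfl⟩ := ih
    rw [gen_inv_eq hn hσ hψ hχ hx]
    exact gen_mul_word hn hσ hψ hχ hW hx e α β γ δ

/-- The words ARE the subgroup generated by `σ, ψ, χ` (as a set). [cite: Fischler2002Polyzetas, §3 Proposition 3.1] -/
theorem coe_closure_eq_range (hn : 3 ≤ n) (hσ : ⇑gσ = sigma) (hψ : ⇑gψ = psi n) (hχ : ⇑gχ = chi n)
    (hW : ∀ e α β γ δ, W e α β γ δ = (bif e then gψ else 1) * (bif α then gσ else 1) *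
      (bif β then gψ * gχ * gψ else 1) * (bif γ then gχ else 1) * (bif δ then gψ * gσ * gψ else 1)) :
    (Subgroup.closure ({gσ, gψ, gχ} : Set (Equiv.Perm Exponents)) : Set (Equiv.Perm Exponents)) =
      Set.range (fun v : Bool × Bool × Bool × Bool × Bool => W v.1 v.2.1 v.2.2.1 v.2.2.2.1 v.2.2.2.2) := by
  ext g
  constructor
  · intro hg
    obtain ⟨e, α, β, γ, δ, rfl⟩ := exists_word_of_mem_closure hn hσ hψ hχ hW hg
    exact ⟨(e, α, β, γ, δ), rfl⟩
  · rintro ⟨v, rfl⟩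
    exact word_mem_closure hW _ _ _ _ _

end Closure

/-! ### The 32 words are pairwise distinct: evaluation at one test point -/

section Card

variable {n : ℕ} {gσ gψ gχ : Equiv.Perm Exponents}
  {W : Bool → Bool → Bool → Bool → Bool → Equiv.Perm Exponents}

/-- Evaluation of the 32 words at the test point `a₁ = 1, a₂ = 2, b₂ = 5, a_n = n+10, b_n = n+20, c_n = n+12`
(all other coordinates `0`), coordinate `a₁` of the image. [cite: Fischler2002Polyzetas, §3 Proposition 3.1] -/
theorem word_testPoint_a_one (hn : 3 ≤ n) (hσ : ⇑gσ = sigma) (hψ : ⇑gψ = psi n) (hχ : ⇑gχ = chi n)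
    (hW : ∀ e α β γ δ, W e α β γ δ = (bif e then gψ else 1) * (bif α then gσ else 1) *
      (bif β then gψ * gχ * gψ else 1) * (bif γ then gχ else 1) * (bif δ then gψ * gσ * gψ else 1))
    (e α β γ δ : Bool) :
    (W e α β γ δ ⟨fun k => if k = 1 then 1 else if k = 2 then 2 else if k = n then (n : ℤ) + 10 else 0,
        fun k => if k = 2 then 5 else if k = n then (n : ℤ) + 20 else 0,
        fun k => if k = n then (n : ℤ) + 12 else 0⟩).a 1 =
      (bif e then (n : ℤ) + (bif γ then (bif δ then 18 else 12) else (bif δ then 20 else 10))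
        else (bif α then (bif β then -1 else 5) else (bif β then 7 else 1))) := by
  have h1n : (1 : ℕ) ≠ n := by omega
  have h2n : (2 : ℕ) ≠ n := by omega
  have hn1 : n ≠ 1 := by omega
  have hn2 : n ≠ 2 := by omega
  have h1le : 1 ≤ n := by omega
  have h1n1 : (1 : ℕ) ≠ n - 1 := by omega
  have e1 : n + 1 - 1 = n := by omega
  cases e <;> cases α <;> cases β <;> cases γ <;> cases δ <;>
    simp only [hW, cond_true, cond_false, one_mul, mul_one, Equiv.Perm.mul_apply, Equiv.Perm.one_apply,
      hσ, hψ, hχ, psi_chi_psi_eq hn, psi_sigma_psi_eq hn] <;>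
    simp only [sigma, chi, psi, h1n, h2n, hn1, hn2, h1le, h1n1, le_refl, and_self, and_true,
      if_true, if_false, e1] <;>
    omega

/-- Evaluation of the 32 words at the same test point, coordinate `a_n` of the image.
[cite: Fischler2002Polyzetas, §3 Proposition 3.1] -/
theorem word_testPoint_a_last (hn : 3 ≤ n) (hσ : ⇑gσ = sigma) (hψ : ⇑gψ = psi n) (hχ : ⇑gχ = chi n)
    (hW : ∀ e α β γ δ, W e α β γ δ = (bif e then gψ else 1) * (bif α then gσ else 1) *
      (bif β then gψ * gχ * gψ else 1) * (bif γ then gχ else 1) * (bif δ then gψ * gσ * gψ else 1))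
    (e α β γ δ : Bool) :
    (W e α β γ δ ⟨fun k => if k = 1 then 1 else if k = 2 then 2 else if k = n then (n : ℤ) + 10 else 0,
        fun k => if k = 2 then 5 else if k = n then (n : ℤ) + 20 else 0,
        fun k => if k = n then (n : ℤ) + 12 else 0⟩).a n =
      (bif e then (bif α then (bif β then -1 else 5) else (bif β then 7 else 1))
        else (n : ℤ) + (bif γ then (bif δ then 18 else 12) else (bif δ then 20 else 10))) := by
  have h1n : (1 : ℕ) ≠ n := by omega
  have h2n : (2 : ℕ) ≠ n := by omega
  have hn1 : n ≠ 1 := by omega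
  have hn2 : n ≠ 2 := by omega
  have h1le : 1 ≤ n := by omega
  have h1n1 : (1 : ℕ) ≠ n - 1 := by omega
  have e2 : n + 1 - n = 1 := by omega
  cases e <;> cases α <;> cases β <;> cases γ <;> cases δ <;>
    simp only [hW, cond_true, cond_false, one_mul, mul_one, Equiv.Perm.mul_apply, Equiv.Perm.one_apply,
      hσ, hψ, hχ, psi_chi_psi_eq hn, psi_sigma_psi_eq hn] <;>
    simp only [sigma, chi, psi, h1n, h2n, hn1, hn2, h1le, h1n1, le_refl, and_self, and_true,
      if_true, if_false, e2] <;>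
    omega

/-- The pair of test values `(a₁, a_n)` determines the five bits. [folklore] -/
private theorem testValues_injective (n : ℕ) {e α β γ δ e' α' β' γ' δ' : Bool}
    (h1 : (bif e then (n : ℤ) + (bif γ then (bif δ then 18 else 12) else (bif δ then 20 else 10))
        else (bif α then (bif β then -1 else 5) else (bif β then 7 else 1))) =
      (bif e' then (n : ℤ) + (bif γ' then (bif δ' then 18 else 12) else (bif δ' then 20 else 10))
        else (bif α' then (bif β' then -1 else 5) else (bif β' then 7 else 1))))
    (h2 : (bif e then (bif α then (bif β then -1 else 5) else (bif β then 7 else 1))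
        else (n : ℤ) + (bif γ then (bif δ then 18 else 12) else (bif δ then 20 else 10))) =
      (bif e' then (bif α' then (bif β' then -1 else 5) else (bif β' then 7 else 1))
        else (n : ℤ) + (bif γ' then (bif δ' then 18 else 12) else (bif δ' then 20 else 10)))) :
    e = e' ∧ α = α' ∧ β = β' ∧ γ = γ' ∧ δ = δ' := by
  cases e <;> cases e' <;> cases α <;> cases α' <;> cases β <;> cases β' <;>
    simp only [cond_true, cond_false] at h1 h2 <;>
    (try (exfalso; omega)) <;>
    cases γ <;> cases γ' <;> cases δ <;> cases δ' <;> simp only [cond_true, cond_false] at h1 h2 <;>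
    first | exact ⟨rfl, rfl, rfl, rfl, rfl⟩ | (exfalso; omega)

/-- The word map `Bool⁵ → ⟨σ, ψ, χ⟩` is injective: the 32 words are pairwise distinct permutations, for every
`n ≥ 3`. [cite: Fischler2002Polyzetas, §3 Proposition 3.1] -/
theorem word_injective (hn : 3 ≤ n) (hσ : ⇑gσ = sigma) (hψ : ⇑gψ = psi n) (hχ : ⇑gχ = chi n)
    (hW : ∀ e α β γ δ, W e α β γ δ = (bif e then gψ else 1) * (bif α then gσ else 1) *
      (bif β then gψ * gχ * gψ else 1) * (bif γ then gχ else 1) * (bif δ then gψ * gσ * gψ else 1)) :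
    Function.Injective (fun v : Bool × Bool × Bool × Bool × Bool => W v.1 v.2.1 v.2.2.1 v.2.2.2.1 v.2.2.2.2) := by
  rintro ⟨e, α, β, γ, δ⟩ ⟨e', α', β', γ', δ'⟩ h
  have h1 := congrArg (fun g : Equiv.Perm Exponents =>
    (g ⟨fun k => if k = 1 then 1 else if k = 2 then 2 else if k = n then (n : ℤ) + 10 else 0,
        fun k => if k = 2 then 5 else if k = n then (n : ℤ) + 20 else 0,
        fun k => if k = n then (n : ℤ) + 12 else 0⟩).a 1) h
  have h2 := congrArg (fun g : Equiv.Perm Exponents =>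
    (g ⟨fun k => if k = 1 then 1 else if k = 2 then 2 else if k = n then (n : ℤ) + 10 else 0,
        fun k => if k = 2 then 5 else if k = n then (n : ℤ) + 20 else 0,
        fun k => if k = n then (n : ℤ) + 12 else 0⟩).a n) h
  simp only at h1 h2
  rw [word_testPoint_a_one hn hσ hψ hχ hW, word_testPoint_a_one hn hσ hψ hχ hW] at h1
  rw [word_testPoint_a_last hn hσ hψ hχ hW, word_testPoint_a_last hn hσ hψ hχ hW] at h2
  obtain ⟨rfl, rfl, rfl, rfl, rfl⟩ := testValues_injective n h1 h2
  rfl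

/-- **The Rhin–Viola group of Proposition 3.1 has order 32**: for every `n ≥ 3`, the subgroup of
`Perm(ℤ^{3n−1})` generated by `σ, ψ, χ` has exactly `32` elements. [cite: Fischler2002Polyzetas, §3 Proposition 3.1]
[cite: Fischler2003RhinViola, §4.3 Théorème 8 p. 524] -/
theorem card_closure_eq (hn : 3 ≤ n) (hσ : ⇑gσ = sigma) (hψ : ⇑gψ = psi n) (hχ : ⇑gχ = chi n) :
    Nat.card (Subgroup.closure ({gσ, gψ, gχ} : Set (Equiv.Perm Exponents))) = 32 := by
  obtain ⟨W, hW⟩ : ∃ W : Bool → Bool → Bool → Bool → Bool → Equiv.Perm Exponents, ∀ e α β γ δ,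
      W e α β γ δ = (bif e then gψ else 1) * (bif α then gσ else 1) *
        (bif β then gψ * gχ * gψ else 1) * (bif γ then gχ else 1) * (bif δ then gψ * gσ * gψ else 1) :=
    ⟨_, fun _ _ _ _ _ => rfl⟩
  rw [← SetLike.coe_sort_coe, coe_closure_eq_range hn hσ hψ hχ hW,
    Nat.card_range_of_injective (word_injective hn hσ hψ hχ hW)]
  simp

end Card

end Prop31

end Literature.NumberTheory.Irrationality.Fischler2002
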